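import Summits.Langlands.Langlands.Theorems.PhantomRMYoshidaResiduallyYoshidaLiftingBlockSumConj
import Literature.RepresentationTheory.Semisimple.Multiplicity
import Literature.RepresentationTheory.Semisimple.MultiplicityDecomposition
import Literature.RepresentationTheory.Semisimple.BrauerNesbitt
import Literature.RepresentationTheory.Semisimple.SubrepresentationEquiv
import Mathlib.LinearAlgebra.Matrix.ToLin
import Mathlib.LinearAlgebra.Matrix.GeneralLinearGroup.Defs
import Mathlib.LinearAlgebra.Charpoly.ToMatrix
import Mathlib.RepresentationTheory.Irreducible
import HarnessLib

/-!
# Route `PhantomRMYoshida`, crux `ResiduallyYoshidaLifting` (stmt-Langlands-13639), line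
# `sector-klingen-split`: stub `stub_blockOrientation` — orientation of the residual diagonal
# blocks against `(σ, σ')`

The registered stub `stub_blockOrientation` of the checked skeleton of line `sector-klingen-split`
(input of Ribet's non-split lattice over `ℤ̄_p`): `k₀ → k` an embedding of fields into an
algebraically closed field (`f`), `Γ` a group, `a, d : Γ → GL₂(k₀)` with `fa := f ∘ a`,
`fd := f ∘ d` irreducible on `k²`, `σ, σ' : Γ → GL₂(k)` irreducible on `k²` and NOT conjugate in
`GL₂(k)`, and `det(X - fa g) · det(X - fd g) = det(X - σ g) · det(X - σ' g)` for all `g`.  Then the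
orientation is uniform in `g`: either `fa ∼ σ` and `fd ∼ σ'`, or `fa ∼ σ'` and `fd ∼ σ`
(conjugate in `GL₂(k)`).

Proof (multiplicities).  The direct sums `ρ_{fa} ⊕ ρ_{fd}` and `ρ_σ ⊕ ρ_{σ'}` of the standard
representations on `k²` (Mathlib `Representation.prod`, on `k² × k²`) are semisimple with equal
characteristic polynomials (`LinearMap.charpoly_prodMap`), hence equivalent by the Brauer–Nesbitt
theorem over an arbitrary field (`Representation.nonempty_equiv_of_charpoly_eq`, Bourbaki A VIII
§ 20 n° 6 Thm 2 Cor 1).  Multiplicities `[ρ : U] = dim Hom_Γ(U, ρ)` are additive and invariant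
under equivalence (`Representation.mult_prod`, `Representation.mult_congr_right`), and by Schur
`[S : U] ∈ {0, 1}` for irreducibles according as `U ≃ S` or not; since `ρ_σ ≄ ρ_{σ'}` (an
equivalence of standard representations is an intertwining invertible matrix, i.e. a conjugator),
`[ρ_{fa} : ρ_σ] + [ρ_{fd} : ρ_σ] = [ρ_σ : ρ_σ] + [ρ_{σ'} : ρ_σ] = 1 + 0`, and likewise for `σ'`;
so exactly one of `fa, fd` is equivalent to `σ`, exactly one to `σ'`, and not the same one (else
`σ ≃ σ'`).  Equivalences of standard representations are conjugacies (`LinearMap.toMatrix'`).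

References: N. Bourbaki, *Algèbre* VIII (2012), § 20 n° 6, Thm 2, Cor 1 [BourbakiAlgebreVIII2012].
Lead `prover-line-stmt-Langlands-13639-c2-0`, line `sector-klingen-split`.
-/

noncomputable section

-- `Summit.Langlands.Langlands.…` (summit = sub-problem name, D-0017 layout) trips `dupNamespace` on
-- every decl
set_option linter.dupNamespace false
set_option autoImplicit false

open scoped MatrixGroups

namespace Summit.Langlands.Langlands.Cruxes.ResiduallyYoshidaLifting.SectorKlingenSplit

open Literature.RepresentationTheory.Semisimple

/-- The characteristic polynomial of `g` in the representation of `Γ` on `kⁿ` through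
`ψ : Γ → GL_n(k)` (Mathlib `Representation.ofDistribMulAction`, i.e. `v ↦ ψ(g) *ᵥ v`) is the
characteristic polynomial of the matrix `ψ(g)`. [folklore] -/
private theorem charpoly_rep_eq {k : Type} [Field k] {Γ : Type} [Group Γ] {n : ℕ}
    (ψ : Γ →* GL (Fin n) k) (g : Γ) :
    (((Representation.ofDistribMulAction k (GL (Fin n) k) (Fin n → k)).comp ψ) g).charpoly =
      ((ψ g : GL (Fin n) k) : Matrix (Fin n) (Fin n) k).charpoly := by
  -- adapted from `…EndoscopicCrossingEuler.charpoly_rep_eq` (BlockSumConj)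
  have hRlin : (((Representation.ofDistribMulAction k (GL (Fin n) k) (Fin n → k)).comp ψ) g :
        (Fin n → k) →ₗ[k] (Fin n → k)) =
      Matrix.toLin' ((ψ g : GL (Fin n) k) : Matrix (Fin n) (Fin n) k) :=
    LinearMap.ext fun v ↦ by rw [Matrix.toLin'_apply]; rfl
  rw [hRlin, Matrix.charpoly_toLin']

/-- The representation on `kⁿ` through `ψ : Γ → GL_n(k)`, as a linear map, is `Matrix.toLin'` of
the matrix `ψ(g)`; hence its matrix in the standard basis is `ψ(g)`. [folklore] -/
private theorem toMatrix'_rep_eq {k : Type} [Field k] {Γ : Type} [Group Γ] {n : ℕ}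
    (ψ : Γ →* GL (Fin n) k) (g : Γ) :
    LinearMap.toMatrix'
        (((Representation.ofDistribMulAction k (GL (Fin n) k) (Fin n → k)).comp ψ) g :
          (Fin n → k) →ₗ[k] (Fin n → k)) =
      ((ψ g : GL (Fin n) k) : Matrix (Fin n) (Fin n) k) := by
  -- adapted from `…EndoscopicCrossingEuler.toMatrix'_rep_eq` (BlockSumConj)
  have hRlin : (((Representation.ofDistribMulAction k (GL (Fin n) k) (Fin n → k)).comp ψ) g :
        (Fin n → k) →ₗ[k] (Fin n → k)) =
      Matrix.toLin' ((ψ g : GL (Fin n) k) : Matrix (Fin n) (Fin n) k) :=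
    LinearMap.ext fun v ↦ by rw [Matrix.toLin'_apply]; rfl
  rw [hRlin, LinearMap.toMatrix'_toLin']

/-- An irreducible representation is semisimple (a simple bounded lattice is complemented).
[folklore] -/
private theorem isSemisimple_of_isIrreducible {k : Type} [Field k] {Γ : Type} [Group Γ]
    {V : Type} [AddCommGroup V] [Module k V] (ρ : Representation k Γ V)
    (h : ρ.IsIrreducible) : ρ.IsSemisimpleRepresentation := by
  haveI : IsSimpleOrder (Subrepresentation ρ) := h
  exact (inferInstance : ComplementedLattice (Subrepresentation ρ))

/-- **Equivalent matrix representations are conjugate.**  An equivalence of the representations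
of `Γ` on `kⁿ` through `ψ₁, ψ₂ : Γ → GL_n(k)` is an invertible matrix `H` (its matrix in the
standard basis, `LinearMap.toMatrix'`) with `H ψ₁(g) = ψ₂(g) H`, i.e. `H ψ₁(g) H⁻¹ = ψ₂(g)`.
[folklore] -/
private theorem exists_conj_of_equiv {k : Type} [Field k] {Γ : Type} [Group Γ] {n : ℕ}
    (ψ₁ ψ₂ : Γ →* GL (Fin n) k)
    (e : Representation.Equiv
      ((Representation.ofDistribMulAction k (GL (Fin n) k) (Fin n → k)).comp ψ₁)
      ((Representation.ofDistribMulAction k (GL (Fin n) k) (Fin n → k)).comp ψ₂)) :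
    ∃ h : GL (Fin n) k, ∀ g, h * ψ₁ g * h⁻¹ = ψ₂ g := by
  -- adapted from `…EndoscopicCrossingEuler.exists_conj_of_charpoly_eq` (BlockSumConj)
  set E : (Fin n → k) ≃ₗ[k] (Fin n → k) := e.toLinearEquiv with hE
  set H : Matrix (Fin n) (Fin n) k := LinearMap.toMatrix' (E : (Fin n → k) →ₗ[k] (Fin n → k))
    with hH
  set H' : Matrix (Fin n) (Fin n) k :=
    LinearMap.toMatrix' (E.symm : (Fin n → k) →ₗ[k] (Fin n → k)) with hH'
  have hHH' : H * H' = 1 := by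
    rw [hH, hH', ← LinearMap.toMatrix'_comp, LinearEquiv.comp_symm, LinearMap.toMatrix'_id]
  have hH'H : H' * H = 1 := by
    rw [hH, hH', ← LinearMap.toMatrix'_comp, LinearEquiv.symm_comp, LinearMap.toMatrix'_id]
  -- the intertwining identity in matrix form
  have hint : ∀ g, H * ((ψ₁ g : GL (Fin n) k) : Matrix (Fin n) (Fin n) k) =
      ((ψ₂ g : GL (Fin n) k) : Matrix (Fin n) (Fin n) k) * H := fun g ↦ by
    have h1 : (E : (Fin n → k) →ₗ[k] (Fin n → k)) ∘ₗ
          (((Representation.ofDistribMulAction k (GL (Fin n) k) (Fin n → k)).comp ψ₁) g) =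
        (((Representation.ofDistribMulAction k (GL (Fin n) k) (Fin n → k)).comp ψ₂) g) ∘ₗ
          (E : (Fin n → k) →ₗ[k] (Fin n → k)) :=
      e.toIntertwiningMap.isIntertwining' g
    have h2 := congrArg LinearMap.toMatrix' h1
    rw [LinearMap.toMatrix'_comp, LinearMap.toMatrix'_comp, toMatrix'_rep_eq, toMatrix'_rep_eq]
      at h2
    exact h2
  refine ⟨⟨H, H', hHH', hH'H⟩, fun g ↦ Units.ext ?_⟩
  change H * ((ψ₁ g : GL (Fin n) k) : Matrix (Fin n) (Fin n) k) * H' =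
    ((ψ₂ g : GL (Fin n) k) : Matrix (Fin n) (Fin n) k)
  rw [hint g, Matrix.mul_assoc, hHH', Matrix.mul_one]

/-- **Stub `stub_blockOrientation` (Brauer–Nesbitt orientation of the residual diagonal blocks
against `(σ, σ')`).**  For an embedding `f : k₀ → k` into an algebraically closed field, a group
`Γ`, `a, d : Γ → GL₂(k₀)` with `f ∘ a`, `f ∘ d` irreducible on `k²`, and `σ, σ' : Γ → GL₂(k)`
irreducible on `k²` and not conjugate, the identity
`det(X - f(a g)) det(X - f(d g)) = det(X - σ g) det(X - σ' g)` for all `g` forces, uniformly in `g`,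
either `f ∘ a ∼ σ, f ∘ d ∼ σ'` or `f ∘ a ∼ σ', f ∘ d ∼ σ` (conjugacy in `GL₂(k)`).  Why true:
`ρ_{fa} ⊕ ρ_{fd} ≃ ρ_σ ⊕ ρ_{σ'}` by Brauer–Nesbitt (`Representation.nonempty_equiv_of_charpoly_eq`),
and counting multiplicities of the irreducibles `ρ_σ`, `ρ_{σ'}` (Schur, `k` algebraically closed;
`ρ_σ ≄ ρ_{σ'}`) on both sides gives `[fa : σ] + [fd : σ] = 1 = [fa : σ'] + [fd : σ']` with the two
`1`'s at different places; an equivalence of standard representations is a conjugating matrix.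
[cite: BourbakiAlgebreVIII2012, VIII § 20 n° 6, Thm. 2, Cor. 1 (p. 378)] -/
theorem stub_blockOrientation :
    ∀ (k₀ k : Type) [Field k₀] [Field k] [IsAlgClosed k] (f : k₀ →+* k) (Γ : Type) [Group Γ]
      (a d : Γ →* GL (Fin 2) k₀) (σ σ' : Γ →* GL (Fin 2) k),
      Representation.IsIrreducible ((Representation.ofDistribMulAction k (GL (Fin 2) k) (Fin 2 → k)).comp
        ((Matrix.GeneralLinearGroup.map f).comp a)) →
      Representation.IsIrreducible ((Representation.ofDistribMulAction k (GL (Fin 2) k) (Fin 2 → k)).comp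
        ((Matrix.GeneralLinearGroup.map f).comp d)) →
      Representation.IsIrreducible ((Representation.ofDistribMulAction k (GL (Fin 2) k) (Fin 2 → k)).comp σ) →
      Representation.IsIrreducible ((Representation.ofDistribMulAction k (GL (Fin 2) k) (Fin 2 → k)).comp σ') →
      (¬ ∃ g : GL (Fin 2) k, ∀ x, g * σ x * g⁻¹ = σ' x) →
      (∀ g, (Matrix.GeneralLinearGroup.map f (a g)).val.charpoly * (Matrix.GeneralLinearGroup.map f (d g)).val.charpoly =
        (σ g).val.charpoly * (σ' g).val.charpoly) →
      (∃ h₁ h₂ : GL (Fin 2) k, ∀ g, h₁ * Matrix.GeneralLinearGroup.map f (a g) * h₁⁻¹ = σ g ∧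
          h₂ * Matrix.GeneralLinearGroup.map f (d g) * h₂⁻¹ = σ' g) ∨
      (∃ h₁ h₂ : GL (Fin 2) k, ∀ g, h₁ * Matrix.GeneralLinearGroup.map f (a g) * h₁⁻¹ = σ' g ∧
          h₂ * Matrix.GeneralLinearGroup.map f (d g) * h₂⁻¹ = σ g) := by
  intro k₀ k _ _ _ f Γ _ a d σ σ' ha hd hσ hσ' hnc hcp
  -- the four standard representations on `k²`
  set fa : Γ →* GL (Fin 2) k := (Matrix.GeneralLinearGroup.map f).comp a with hfa
  set fd : Γ →* GL (Fin 2) k := (Matrix.GeneralLinearGroup.map f).comp d with hfd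
  set ρa : Representation k Γ (Fin 2 → k) :=
    (Representation.ofDistribMulAction k (GL (Fin 2) k) (Fin 2 → k)).comp fa with hρa
  set ρd : Representation k Γ (Fin 2 → k) :=
    (Representation.ofDistribMulAction k (GL (Fin 2) k) (Fin 2 → k)).comp fd with hρd
  set ρσ : Representation k Γ (Fin 2 → k) :=
    (Representation.ofDistribMulAction k (GL (Fin 2) k) (Fin 2 → k)).comp σ with hρσ
  set ρσ' : Representation k Γ (Fin 2 → k) :=
    (Representation.ofDistribMulAction k (GL (Fin 2) k) (Fin 2 → k)).comp σ' with hρσ'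
  haveI : ρa.IsIrreducible := ha
  haveI : ρd.IsIrreducible := hd
  haveI : ρσ.IsIrreducible := hσ
  haveI : ρσ'.IsIrreducible := hσ'
  haveI : ρa.IsSemisimpleRepresentation := isSemisimple_of_isIrreducible _ ha
  haveI : ρd.IsSemisimpleRepresentation := isSemisimple_of_isIrreducible _ hd
  haveI : ρσ.IsSemisimpleRepresentation := isSemisimple_of_isIrreducible _ hσ
  haveI : ρσ'.IsSemisimpleRepresentation := isSemisimple_of_isIrreducible _ hσ'
  -- Brauer–Nesbitt for the direct sums `ρa ⊕ ρd`, `ρσ ⊕ ρσ'`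
  have hcp' : ∀ g, ((ρa.prod ρd) g).charpoly = ((ρσ.prod ρσ') g).charpoly := fun g ↦ by
    change ((ρa g).prodMap (ρd g)).charpoly = ((ρσ g).prodMap (ρσ' g)).charpoly
    rw [LinearMap.charpoly_prodMap, LinearMap.charpoly_prodMap, hρa, hρd, hρσ, hρσ',
      charpoly_rep_eq, charpoly_rep_eq, charpoly_rep_eq, charpoly_rep_eq]
    exact hcp g
  obtain ⟨e⟩ := Representation.nonempty_equiv_of_charpoly_eq (ρa.prod ρd) (ρσ.prod ρσ') hcp'
  -- `ρσ ≄ ρσ'` (an equivalence would be a conjugator)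
  have hne : IsEmpty (ρσ.Equiv ρσ') := ⟨fun e' ↦ hnc (exists_conj_of_equiv σ σ' e')⟩
  have hne' : IsEmpty (ρσ'.Equiv ρσ) := ⟨fun e' ↦ hnc (exists_conj_of_equiv σ σ' e'.symm)⟩
  -- multiplicities of `ρσ`, `ρσ'` in `ρa ⊕ ρd ≃ ρσ ⊕ ρσ'`
  have hmσ : Representation.mult ρσ ρa + Representation.mult ρσ ρd = 1 := by
    rw [← Representation.mult_prod, Representation.mult_congr_right ρσ e, Representation.mult_prod,
      Representation.mult_self, Representation.mult_eq_zero_of_isEmpty_equiv hne]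
  have hmσ' : Representation.mult ρσ' ρa + Representation.mult ρσ' ρd = 1 := by
    rw [← Representation.mult_prod, Representation.mult_congr_right ρσ' e, Representation.mult_prod,
      Representation.mult_self, Representation.mult_eq_zero_of_isEmpty_equiv hne']
  by_cases h1 : Nonempty (ρσ.Equiv ρa)
  · -- `fa ∼ σ`, hence `fd ∼ σ'`
    obtain ⟨e₁⟩ := h1
    have h2 : Nonempty (ρσ'.Equiv ρd) := by
      by_contra h2
      have h3 : IsEmpty (ρσ'.Equiv ρa) := ⟨fun e₃ ↦ hne.false (e₁.trans e₃.symm)⟩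
      rw [Representation.mult_eq_zero_of_isEmpty_equiv h3,
        Representation.mult_eq_zero_of_isEmpty_equiv (not_nonempty_iff.mp h2)] at hmσ'
      exact absurd hmσ' (by norm_num)
    obtain ⟨e₂⟩ := h2
    obtain ⟨h₁, hh₁⟩ := exists_conj_of_equiv fa σ e₁.symm
    obtain ⟨h₂, hh₂⟩ := exists_conj_of_equiv fd σ' e₂.symm
    exact Or.inl ⟨h₁, h₂, fun g ↦ ⟨hh₁ g, hh₂ g⟩⟩
  · -- `fa ≁ σ`, hence `fd ∼ σ` and `fa ∼ σ'`
    have h1' : IsEmpty (ρσ.Equiv ρa) := not_nonempty_iff.mp h1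
    have h2 : Nonempty (ρσ.Equiv ρd) := by
      by_contra h2
      rw [Representation.mult_eq_zero_of_isEmpty_equiv h1',
        Representation.mult_eq_zero_of_isEmpty_equiv (not_nonempty_iff.mp h2)] at hmσ
      exact absurd hmσ (by norm_num)
    obtain ⟨e₂⟩ := h2
    have h3 : Nonempty (ρσ'.Equiv ρa) := by
      by_contra h3
      have h4 : IsEmpty (ρσ'.Equiv ρd) := ⟨fun e₄ ↦ hne.false (e₂.trans e₄.symm)⟩
      rw [Representation.mult_eq_zero_of_isEmpty_equiv (not_nonempty_iff.mp h3),
        Representation.mult_eq_zero_of_isEmpty_equiv h4] at hmσ'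
      exact absurd hmσ' (by norm_num)
    obtain ⟨e₃⟩ := h3
    obtain ⟨h₁, hh₁⟩ := exists_conj_of_equiv fa σ' e₃.symm
    obtain ⟨h₂, hh₂⟩ := exists_conj_of_equiv fd σ e₂.symm
    exact Or.inr ⟨h₁, h₂, fun g ↦ ⟨hh₁ g, hh₂ g⟩⟩

end Summit.Langlands.Langlands.Cruxes.ResiduallyYoshidaLifting.SectorKlingenSplit

end
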